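import Summits.NavierStokesRegularity.OSWSelfSimilar.SheetNSLineSchochetTwoPoleEnvelope
import Summits.NavierStokesRegularity.OSWSelfSimilar.SheetNSLineViscousCLMUnique
import HarnessLib

/-!
# EVERY classical decaying solution of the viscous CLM on `ℝ` from the small Schochet datum blows up by `T`

HONEST FRAMING (cell ns-blowup GROUP B «PROFILE SEARCH», zone Z3, rows Z3-U (A-F2) / Z3-E12⁻ (clause (i′)) of
`HOME/profile/z3/CENSUS-Z3.md`; human rulings D-0035/D-0074): **1-D MODEL (the viscous Constantin–Lax–Majda equation
`ω_t = ω·Hω + ν ω_xx` on `ℝ`, genuine `hilbertTransform`); not Euler, not Navier–Stokes; «violates: none — MODEL».**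

THE COROLLARY (`viscousCLM_line_every_solution_blows_up`). For every `ν > 0` and `ε > 0` there are `T > 0` and the explicit
Schochet–ALSS solution `(ω, ωₓ, ωₓₓ)` on `[0, T)` (classical, genuine `H`, odd class-3 datum with `sup|ω₀| ≤ ε`, `∫|ω₀| ≤ ε`,
`sup_x|ω(t,·)| → ∞` as `t ↑ T`) such that **EVERY classical decaying solution** `(ω', ω'ₓ, ω'ₓₓ)` of the viscous CLM on some
`[0, T')` — `C²` slices with envelope `|ω'|, |ω'ₓ|, |ω'ₓₓ| ≤ C/(1+x²)`, `|Hω'| ≤ C`, the PDE pointwise on `(0,T')`, right-continuous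
at `t = 0` — **with the same datum `ω'(0,·) = ω(0,·)` satisfies `T' ≤ T` and coincides with `ω` on `[0, T')`.** So on the MODEL
the NS-type dissipation does not save ANY classical decaying solution from arbitrarily small smooth odd data on `ℝ` (contrast: on
`𝕋` every classical solution from `−c sin x`, `c < 12ν`, is global — `SheetNSLineTorusCascade*`). Ingredients: the uniqueness
theorem `SheetNSLineViscousCLMUnique.viscousCLM_line_unique` + the envelopes of `SheetNSLineSchochetTwoPoleEnvelope` (the Schochet
solution is in the class on every `[0, T₁]`, `T₁ < T`) + the sup blow-up of `SheetNSLineSchochetTwoPoleReadouts`.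
WHAT IS NOT HERE: weak / non-decaying solutions; anything about Navier–Stokes. No definitions, no named facts.
bears_on: LADDER-NS N5 / zone Z3 → N1 linear core.
-/

noncomputable section

namespace Summit.NavierStokesRegularity.OSWSelfSimilar
namespace SheetNSLineSchochetTwoPole

open _root_.MeasureTheory Set Filter Literature.Analysis.Fourier SheetNSLineViscousCLMUnique
open scoped Real Topology

section Agree

variable {ν k σ s₀ : ℝ} {s y : ℝ → ℝ} {ω ωx ωxx : ℝ → ℝ → ℝ}

/-- `s` is monotone on `t ≥ 0` and `≥ s₀`; hence `y` is antitone there. [folklore] -/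
theorem depth_antitone (hν : 0 < ν) (hk0 : 0 < k) (hs₀ : 0 < s₀)
    (hs : ∀ t, s t = Real.sqrt (s₀ ^ 2 + 40 * k * ν * t)) (hy : ∀ t, y t = (σ - s t) / 2)
    {t t' : ℝ} (ht : 0 ≤ t) (htt' : t ≤ t') : s₀ ≤ s t ∧ y t' ≤ y t := by
  have h40 : 0 ≤ 40 * k * ν := by positivity
  refine ⟨?_, ?_⟩
  · rw [hs]
    calc s₀ = Real.sqrt (s₀ ^ 2) := (Real.sqrt_sq hs₀.le).symm
      _ ≤ Real.sqrt (s₀ ^ 2 + 40 * k * ν * t) := Real.sqrt_le_sqrt (le_add_of_nonneg_right (by positivity))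
  · rw [hy, hy, hs, hs]
    have : Real.sqrt (s₀ ^ 2 + 40 * k * ν * t) ≤ Real.sqrt (s₀ ^ 2 + 40 * k * ν * t') :=
      Real.sqrt_le_sqrt (by nlinarith)
    linarith

/-- **Agreement before the blow-up time.** On every `[0, T₁)` with `T₁ < T` and `T₁ ≤ T'`, a classical decaying solution
`ω'` on `[0,T')` with the Schochet datum coincides with the Schochet solution (uniqueness theorem + envelopes). [folklore] -/
theorem agree_before_blowup (hν : 0 < ν) (hk0 : 0 < k) (hk : k ^ 2 - 6 * k + 3 = 0) (hs₀ : 0 < s₀) (hs₀σ : s₀ < σ)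
    (hs : ∀ t, s t = Real.sqrt (s₀ ^ 2 + 40 * k * ν * t)) (hy : ∀ t, y t = (σ - s t) / 2)
    (hω : ∀ t x, ω t x = (-24 * k * ν / s t) * (x / (x ^ 2 + y t ^ 2) - x / (x ^ 2 + (y t + s t) ^ 2))
      + (-12 * ν) * (2 * y t * x / (x ^ 2 + y t ^ 2) ^ 2 + 2 * (y t + s t) * x / (x ^ 2 + (y t + s t) ^ 2) ^ 2))
    (hωx : ∀ t x, ωx t x = (-24 * k * ν / s t) * ((y t ^ 2 - x ^ 2) / (x ^ 2 + y t ^ 2) ^ 2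
        - ((y t + s t) ^ 2 - x ^ 2) / (x ^ 2 + (y t + s t) ^ 2) ^ 2)
      + (-12 * ν) * (2 * y t * (y t ^ 2 - 3 * x ^ 2) / (x ^ 2 + y t ^ 2) ^ 3
        + 2 * (y t + s t) * ((y t + s t) ^ 2 - 3 * x ^ 2) / (x ^ 2 + (y t + s t) ^ 2) ^ 3))
    (hωxx : ∀ t x, ωxx t x = (-24 * k * ν / s t) * (2 * x * (x ^ 2 - 3 * y t ^ 2) / (x ^ 2 + y t ^ 2) ^ 3
        - 2 * x * (x ^ 2 - 3 * (y t + s t) ^ 2) / (x ^ 2 + (y t + s t) ^ 2) ^ 3)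
      + (-12 * ν) * (24 * y t * x * (x ^ 2 - y t ^ 2) / (x ^ 2 + y t ^ 2) ^ 4
        + 24 * (y t + s t) * x * (x ^ 2 - (y t + s t) ^ 2) / (x ^ 2 + (y t + s t) ^ 2) ^ 4))
    {T' C : ℝ} {ω' ωx' ωxx' : ℝ → ℝ → ℝ} (hC : 0 ≤ C)
    (hx' : ∀ t ∈ Ico 0 T', ∀ x, HasDerivAt (ω' t) (ωx' t x) x)
    (hxx' : ∀ t ∈ Ico 0 T', ∀ x, HasDerivAt (ωx' t) (ωxx' t x) x)
    (hb' : ∀ t ∈ Ico 0 T', ∀ x, |ω' t x| ≤ C / (1 + x ^ 2) ∧ |ωx' t x| ≤ C / (1 + x ^ 2) ∧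
      |ωxx' t x| ≤ C / (1 + x ^ 2) ∧ |hilbertTransform (ω' t) x| ≤ C)
    (ht' : ∀ t ∈ Ioo 0 T', ∀ x,
      HasDerivAt (fun τ => ω' τ x) (ω' t x * hilbertTransform (ω' t) x + ν * ωxx' t x) t)
    (hc' : ∀ x, ContinuousWithinAt (fun τ => ω' τ x) (Ici 0) 0)
    (h0 : ∀ x, ω' 0 x = ω 0 x) {T₁ : ℝ} (hT₁ : T₁ < (σ ^ 2 - s₀ ^ 2) / (40 * k * ν)) (hT₁' : T₁ ≤ T') :
    ∀ t ∈ Ico 0 T₁, ∀ x, ω' t x = ω t x := by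
  have hσ : 0 < σ := hs₀.trans hs₀σ
  -- positivity on `[0, T₁]`
  have hrad : ∀ t, 0 ≤ t → 0 < s₀ ^ 2 + 40 * k * ν * t := fun t ht => radicand_pos hν hk0 hs₀ ht
  have hst : ∀ t, 0 ≤ t → 0 < s t := fun t ht => sep_pos hs (hrad t ht)
  have hyt : ∀ t, t < (σ ^ 2 - s₀ ^ 2) / (40 * k * ν) → 0 < y t := fun t ht => depth_pos hν hk0 hσ hs hy ht
  rcases lt_or_ge T₁ 0 with hneg | hT₁0
  · intro t ht; exact absurd (ht.1.trans_lt ht.2) (not_lt.2 hneg.le)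
  -- the Schochet envelope constant on `[0, T₁]`: `m = y T₁`, `s ≥ s₀`
  set m := y T₁ with hm
  have hm0 : 0 < m := hyt T₁ hT₁
  set CS : ℝ := 24 * (k + 1) * ν * (1 + 1 / m ^ 2) + (2 * (24 * k * ν / s₀) + 144 * ν / m) * (1 + 1 / m ^ 2)
    + (2 * (24 * k * ν / s₀) * (3 / m) + 24 * ν * (12 / m ^ 2)) * (1 + 1 / m ^ 2)
    + (2 * (24 * k * ν / s₀) * (1 / m) + 24 * ν * (1 / m ^ 2)) with hCS
  have hE1 : 0 ≤ 24 * (k + 1) * ν * (1 + 1 / m ^ 2) := by positivity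
  have hE2 : 0 ≤ (2 * (24 * k * ν / s₀) + 144 * ν / m) * (1 + 1 / m ^ 2) := by positivity
  have hE3 : 0 ≤ (2 * (24 * k * ν / s₀) * (3 / m) + 24 * ν * (12 / m ^ 2)) * (1 + 1 / m ^ 2) := by positivity
  have hE4 : 0 ≤ 2 * (24 * k * ν / s₀) * (1 / m) + 24 * ν * (1 / m ^ 2) := by positivity
  set Cm := max C CS with hCm
  have hCCm : C ≤ Cm := le_max_left _ _
  have hSCm : CS ≤ Cm := le_max_right _ _
  have hCm0 : 0 ≤ Cm := hC.trans hCCm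
  have mono : ∀ {a K K' : ℝ} {x : ℝ}, |a| ≤ K / (1 + x ^ 2) → K ≤ K' → |a| ≤ K' / (1 + x ^ 2) :=
    fun h hK => h.trans (div_le_div_of_nonneg_right hK (by positivity))
  -- apply the uniqueness theorem on `[0, T₁)` with constant `Cm`
  have hU := viscousCLM_line_unique (T := T₁) (C := Cm) (ν := ν) hν.le hCm0
    (ω₁ := ω') (ωx₁ := ωx') (ωxx₁ := ωxx') (ω₂ := ω) (ωx₂ := ωx) (ωxx₂ := ωxx)
    (fun t ht x => hx' t ⟨ht.1, ht.2.trans_le hT₁'⟩ x)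
    (fun t ht x => hxx' t ⟨ht.1, ht.2.trans_le hT₁'⟩ x)
    (fun t ht x => by
      obtain ⟨a1, a2, a3, a4⟩ := hb' t ⟨ht.1, ht.2.trans_le hT₁'⟩ x
      exact ⟨mono a1 hCCm, mono a2 hCCm, mono a3 hCCm, a4.trans hCCm⟩)
    (fun t ht x => ht' t ⟨ht.1, ht.2.trans_le hT₁'⟩ x) hc'
    (fun t ht x => hasDerivAt_solution_x hω hωx (hyt t (ht.2.trans hT₁)) (hst t ht.1) x)
    (fun t ht x => hasDerivAt_solution_xx hωx hωxx (hyt t (ht.2.trans hT₁)) (hst t ht.1) x)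
    (fun t ht x => by
      obtain ⟨hss, hym⟩ := depth_antitone hν hk0 hs₀ hs hy ht.1 ht.2.le
      refine ⟨mono (env_omega hν hk0 hω hm0 hym (hst t ht.1) x) (by linarith),
        mono (env_omegax hν hk0 hωx hm0 hym hs₀ hss x) (by linarith),
        mono (env_omegaxx hν hk0 hωxx hm0 hym hs₀ hss x) (by linarith),
        (env_H hν hk0 hω hm0 hym hs₀ hss x).trans (by linarith)⟩)
    (fun t ht x => hasDerivAt_solution_t hk hs hy hω hωxx (hrad t ht.1.le) (hyt t (ht.2.trans hT₁)) x)
    (fun x => (hasDerivAt_solution_t hk hs hy hω hωxx (hrad 0 le_rfl)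
      (hyt 0 (hT₁0.trans_lt hT₁)) x).continuousAt.continuousWithinAt)
    h0
  exact hU

end Agree

/-! ### The corollary -/

/-- **On `ℝ`, EVERY classical decaying solution of the viscous CLM from the small Schochet datum blows up by `T`.** For every
`ν > 0`, `ε > 0`: there are `T > 0` and the explicit Schochet–ALSS solution `(ω, ωₓ, ωₓₓ)` — classical on `[0,T)` with the GENUINE
`hilbertTransform`, odd class-3 datum with `sup|ω₀| ≤ ε` and `∫|ω₀| ≤ ε`, `sup_x|ω(t,x)| → ∞` as `t ↑ T` — such that every
classical decaying solution `(ω', ω'ₓ, ω'ₓₓ)` on `[0, T')` (envelope `C/(1+x²)`, `|Hω'| ≤ C`, PDE on `(0,T')`, right-continuous at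
`0`) with `ω'(0,·) = ω(0,·)` has `T' ≤ T` and equals `ω` on `[0,T')`. MODEL statement.
[cite: AmbroseLushnikovSiegelSilantyev2024, §5.1 (Schochet's solution: blow-up from arbitrarily small data on the real line)] -/
theorem viscousCLM_line_every_solution_blows_up (ν ε : ℝ) (hν : 0 < ν) (hε : 0 < ε) :
    ∃ T : ℝ, 0 < T ∧ ∃ ω ωx ωxx : ℝ → ℝ → ℝ,
      (∀ t x, 0 ≤ t → t < T → HasDerivAt (ω t) (ωx t x) x) ∧
      (∀ t x, 0 ≤ t → t < T → HasDerivAt (ωx t) (ωxx t x) x) ∧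
      (∀ t x, 0 ≤ t → t < T →
        HasDerivAt (fun τ => ω τ x) (ω t x * hilbertTransform (ω t) x + ν * ωxx t x) t) ∧
      (∀ x, ω 0 (-x) = -ω 0 x) ∧ (∀ x, 0 < x → ω 0 x ≤ 0) ∧ (∀ x, |ω 0 x| ≤ ε) ∧ (∫ x, |ω 0 x| ≤ ε) ∧
      (∀ M : ℝ, ∀ᶠ t in 𝓝[<] T, ∃ x : ℝ, M ≤ |ω t x|) ∧
      (∀ (T' C : ℝ) (ω' ωx' ωxx' : ℝ → ℝ → ℝ), 0 ≤ C →
        (∀ t ∈ Ico 0 T', ∀ x, HasDerivAt (ω' t) (ωx' t x) x) →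
        (∀ t ∈ Ico 0 T', ∀ x, HasDerivAt (ωx' t) (ωxx' t x) x) →
        (∀ t ∈ Ico 0 T', ∀ x, |ω' t x| ≤ C / (1 + x ^ 2) ∧ |ωx' t x| ≤ C / (1 + x ^ 2) ∧
          |ωxx' t x| ≤ C / (1 + x ^ 2) ∧ |hilbertTransform (ω' t) x| ≤ C) →
        (∀ t ∈ Ioo 0 T', ∀ x,
          HasDerivAt (fun τ => ω' τ x) (ω' t x * hilbertTransform (ω' t) x + ν * ωxx' t x) t) →
        (∀ x, ContinuousWithinAt (fun τ => ω' τ x) (Ici 0) 0) →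
        (∀ x, ω' 0 x = ω 0 x) →
        T' ≤ T ∧ ∀ t ∈ Ico 0 T', ∀ x, ω' t x = ω t x) := by
  obtain ⟨hk, hk0, hk6⟩ := root_k
  set k : ℝ := 3 + Real.sqrt 6 with hkdef
  set L : ℝ := Real.sqrt (123 * ν / ε) + 672 * ν / ε + 1 with hLdef
  have hL : 0 < L := by positivity
  set s : ℝ → ℝ := fun t => Real.sqrt (L ^ 2 + 40 * k * ν * t) with hsdef
  set y : ℝ → ℝ := fun t => (3 * L - s t) / 2 with hydef
  set ω : ℝ → ℝ → ℝ := fun t x => (-24 * k * ν / s t) * (x / (x ^ 2 + y t ^ 2) - x / (x ^ 2 + (y t + s t) ^ 2))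
      + (-12 * ν) * (2 * y t * x / (x ^ 2 + y t ^ 2) ^ 2 + 2 * (y t + s t) * x / (x ^ 2 + (y t + s t) ^ 2) ^ 2)
    with hωdef
  set ωx : ℝ → ℝ → ℝ := fun t x => (-24 * k * ν / s t) * ((y t ^ 2 - x ^ 2) / (x ^ 2 + y t ^ 2) ^ 2
        - ((y t + s t) ^ 2 - x ^ 2) / (x ^ 2 + (y t + s t) ^ 2) ^ 2)
      + (-12 * ν) * (2 * y t * (y t ^ 2 - 3 * x ^ 2) / (x ^ 2 + y t ^ 2) ^ 3
        + 2 * (y t + s t) * ((y t + s t) ^ 2 - 3 * x ^ 2) / (x ^ 2 + (y t + s t) ^ 2) ^ 3) with hωxdef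
  set ωxx : ℝ → ℝ → ℝ := fun t x => (-24 * k * ν / s t) * (2 * x * (x ^ 2 - 3 * y t ^ 2) / (x ^ 2 + y t ^ 2) ^ 3
        - 2 * x * (x ^ 2 - 3 * (y t + s t) ^ 2) / (x ^ 2 + (y t + s t) ^ 2) ^ 3)
      + (-12 * ν) * (24 * y t * x * (x ^ 2 - y t ^ 2) / (x ^ 2 + y t ^ 2) ^ 4
        + 24 * (y t + s t) * x * (x ^ 2 - (y t + s t) ^ 2) / (x ^ 2 + (y t + s t) ^ 2) ^ 4) with hωxxdef
  have hs : ∀ t, s t = Real.sqrt (L ^ 2 + 40 * k * ν * t) := fun t => rfl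
  have hy : ∀ t, y t = (3 * L - s t) / 2 := fun t => rfl
  have hω : ∀ t x, ω t x = (-24 * k * ν / s t) * (x / (x ^ 2 + y t ^ 2) - x / (x ^ 2 + (y t + s t) ^ 2))
      + (-12 * ν) * (2 * y t * x / (x ^ 2 + y t ^ 2) ^ 2 + 2 * (y t + s t) * x / (x ^ 2 + (y t + s t) ^ 2) ^ 2) :=
    fun t x => rfl
  have hωx : ∀ t x, ωx t x = (-24 * k * ν / s t) * ((y t ^ 2 - x ^ 2) / (x ^ 2 + y t ^ 2) ^ 2
        - ((y t + s t) ^ 2 - x ^ 2) / (x ^ 2 + (y t + s t) ^ 2) ^ 2)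
      + (-12 * ν) * (2 * y t * (y t ^ 2 - 3 * x ^ 2) / (x ^ 2 + y t ^ 2) ^ 3
        + 2 * (y t + s t) * ((y t + s t) ^ 2 - 3 * x ^ 2) / (x ^ 2 + (y t + s t) ^ 2) ^ 3) := fun t x => rfl
  have hωxx : ∀ t x, ωxx t x = (-24 * k * ν / s t) * (2 * x * (x ^ 2 - 3 * y t ^ 2) / (x ^ 2 + y t ^ 2) ^ 3
        - 2 * x * (x ^ 2 - 3 * (y t + s t) ^ 2) / (x ^ 2 + (y t + s t) ^ 2) ^ 3)
      + (-12 * ν) * (24 * y t * x * (x ^ 2 - y t ^ 2) / (x ^ 2 + y t ^ 2) ^ 4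
        + 24 * (y t + s t) * x * (x ^ 2 - (y t + s t) ^ 2) / (x ^ 2 + (y t + s t) ^ 2) ^ 4) := fun t x => rfl
  have hσ : (0:ℝ) < 3 * L := by positivity
  have h3L : L < 3 * L := by linarith
  have hT : 0 < ((3 * L) ^ 2 - L ^ 2) / (40 * k * ν) := blowupTime_pos hν hk0 hL h3L
  have hrad : ∀ t, 0 ≤ t → 0 < L ^ 2 + 40 * k * ν * t := fun t ht => radicand_pos hν hk0 hL ht
  have hst : ∀ t, 0 ≤ t → 0 < s t := fun t ht => sep_pos hs (hrad t ht)
  have hyt : ∀ t, t < ((3 * L) ^ 2 - L ^ 2) / (40 * k * ν) → 0 < y t :=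
    fun t ht => depth_pos hν hk0 hσ hs hy ht
  -- sup blow-up (as in the existence theorem)
  have hblow : ∀ M : ℝ, ∀ᶠ t in 𝓝[<] (((3 * L) ^ 2 - L ^ 2) / (40 * k * ν)), ∃ x : ℝ, M ≤ |ω t x| := by
    intro M
    have hup := tendsto_inv_depth_pow hν hk0 hσ hs hy (n := 2) (by norm_num) (by positivity : (0:ℝ) < 6 * ν)
    have hpos : ∀ᶠ t in 𝓝[<] (((3 * L) ^ 2 - L ^ 2) / (40 * k * ν)), 0 < t :=
      (lt_mem_nhds hT).filter_mono nhdsWithin_le_nhds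
    filter_upwards [hpos, self_mem_nhdsWithin, hup.eventually_ge_atTop M] with t ht0 htT hM
    refine ⟨y t, hM.trans ?_⟩
    have h := solution_at_depth_le hν hk0 hω (hyt t htT) (hst t ht0.le)
    have hnn : 0 ≤ 6 * ν / y t ^ 2 := by
      have := hyt t htT
      positivity
    rw [abs_of_nonpos (h.trans (neg_nonpos.2 hnn))]
    linarith
  refine ⟨((3 * L) ^ 2 - L ^ 2) / (40 * k * ν), hT, ω, ωx, ωxx, ?_, ?_, ?_, ?_, ?_, ?_, ?_, hblow, ?_⟩
  · intro t x ht0 htT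
    exact hasDerivAt_solution_x hω hωx (hyt t htT) (hst t ht0) x
  · intro t x ht0 htT
    exact hasDerivAt_solution_xx hωx hωxx (hyt t htT) (hst t ht0) x
  · intro t x ht0 htT
    exact hasDerivAt_solution_t hk hs hy hω hωxx (hrad t ht0) (hyt t htT) x
  · intro x
    exact solution_odd hω 0 x
  · intro x hx
    exact solution_nonpos hν hk0 hω (hyt 0 hT) (hst 0 le_rfl) hx
  · intro x
    refine (solution_initial_abs_le hν hk0 hk6 hL hs hy hω x).trans ?_
    have hL2 : 123 * ν / ε ≤ L ^ 2 := by
      have h1 : Real.sqrt (123 * ν / ε) ≤ L := by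
        rw [hLdef]
        have : 0 ≤ 672 * ν / ε := by positivity
        linarith
      calc 123 * ν / ε = Real.sqrt (123 * ν / ε) ^ 2 := (Real.sq_sqrt (by positivity)).symm
        _ ≤ L ^ 2 := by gcongr
    rw [div_le_iff₀ (by positivity)]
    have := (div_le_iff₀ hε).1 hL2
    linarith
  · have hy0 : y 0 = L := by
      rw [hy, hs]
      simp [Real.sqrt_sq hL.le]
      ring
    have hI := integral_abs_solution_le hν hk0 hω (hyt 0 hT) (hst 0 le_rfl)
      (continuous_iff_continuousAt.2 fun x =>
        (hasDerivAt_solution_x hω hωx (hyt 0 hT) (hst 0 le_rfl) x).continuousAt)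
    rw [hy0] at hI
    refine hI.trans ?_
    have hLge : 672 * ν / ε ≤ L := by
      rw [hLdef]
      have : 0 ≤ Real.sqrt (123 * ν / ε) := Real.sqrt_nonneg _
      linarith
    have h672 : 672 * ν / L ≤ ε := by
      rw [div_le_iff₀ hL]
      have := (div_le_iff₀ hε).1 hLge
      linarith
    refine le_trans ?_ h672
    rw [mul_div_assoc']
    rw [div_le_div_iff₀ hL hL]
    have hpi := Real.pi_le_four
    have hkk : k + 1 ≤ 7 := by linarith
    have h1 : (k + 1) * π ≤ 28 := by
      nlinarith [mul_nonneg (sub_nonneg.2 hkk) Real.pi_pos.le, mul_nonneg (sub_nonneg.2 hpi) (by linarith : (0:ℝ) ≤ k + 1)]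
    have hνL := mul_pos hν hL
    nlinarith [mul_le_mul_of_nonneg_right h1 hνL.le]
  · -- EVERY classical decaying solution with the same datum: lifespan ≤ T and agreement
    intro T' C ω' ωx' ωxx' hC hx' hxx' hb' ht' hc' h0
    have hagree : ∀ T₁, T₁ < ((3 * L) ^ 2 - L ^ 2) / (40 * k * ν) → T₁ ≤ T' →
        ∀ t ∈ Ico 0 T₁, ∀ x, ω' t x = ω t x :=
      fun T₁ hT₁ hT₁' => agree_before_blowup hν hk0 hk hL h3L hs hy hω hωx hωxx hC hx' hxx' hb' ht' hc' h0 hT₁ hT₁'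
    have hle : T' ≤ ((3 * L) ^ 2 - L ^ 2) / (40 * k * ν) := by
      refine le_of_not_gt fun hlt => ?_
      have hpos : ∀ᶠ t in 𝓝[<] (((3 * L) ^ 2 - L ^ 2) / (40 * k * ν)), 0 < t :=
        (lt_mem_nhds hT).filter_mono nhdsWithin_le_nhds
      obtain ⟨t, ⟨x, hx⟩, ht0, htT⟩ := ((hblow (C + 1)).and (hpos.and self_mem_nhdsWithin)).exists
      have htT' : t < ((3 * L) ^ 2 - L ^ 2) / (40 * k * ν) := htT
      have hT₁ : (t + ((3 * L) ^ 2 - L ^ 2) / (40 * k * ν)) / 2 < ((3 * L) ^ 2 - L ^ 2) / (40 * k * ν) := by linarith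
      have hT₁' : (t + ((3 * L) ^ 2 - L ^ 2) / (40 * k * ν)) / 2 ≤ T' := by linarith
      have heq := hagree _ hT₁ hT₁' t ⟨ht0.le, by linarith⟩ x
      have hbd := (hb' t ⟨ht0.le, htT'.trans hlt⟩ x).1
      rw [heq] at hbd
      have : C / (1 + x ^ 2) ≤ C := div_le_self hC (by nlinarith [sq_nonneg x])
      exact absurd (hx.trans hbd) (by linarith)
    refine ⟨hle, fun t ht x => ?_⟩
    have hT₁ : (t + T') / 2 < ((3 * L) ^ 2 - L ^ 2) / (40 * k * ν) := by linarith [ht.2]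
    exact hagree _ hT₁ (by linarith [ht.2]) t ⟨ht.1, by linarith [ht.2]⟩ x

end SheetNSLineSchochetTwoPole
end Summit.NavierStokesRegularity.OSWSelfSimilar

end
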